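import Summits.BirchSwinnertonDyer.BirchSwinnertonDyer.Theorems.AlignedTransportAtTwoMainConjectureTransportAlignedAtTwoRhombicOfNegDisc
import Summits.BirchSwinnertonDyer.BirchSwinnertonDyer.Theorems.AlignedTransportAtTwoMainConjectureOfRankZeroBSDAtTwoFineRoadOddIsogeny
import Literature.NumberTheory.Automorphic.ShimuraCurveRibetTakahashiFreyManinProofs
import Literature.NumberTheory.Automorphic.ShimuraCurveRibetTakahashiOptimalModularityProofs
import Literature.NumberTheory.EllipticCurves.ModularCurvePeriodRatioTwoProofs
import Literature.NumberTheory.EllipticCurves.ModularCurveManinSemistableLatticeFormProofs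
import Literature.NumberTheory.EllipticCurves.IsogenyVariableChangeProofs
import Literature.NumberTheory.EllipticCurves.ModTwoReducibleIffTwoTorsionRoot
import HarnessLib

/-!
# Crux C1 `MainConjectureTransportAlignedAtTwo` (stmt-BirchSwinnertonDyer-22296), line `birth`, plan «deltapos-galois» input T4, DISCHARGED FROM PRINT ALREADY IN
# THE TREE: every curve of the cell admits a parametrisation datum at the level of its conductor with ODD Manin constant (width seat att-p4 g13; `--supports 22296`)

THEOREMS ONLY (no `def`, no `sorry`, no new named fact). CONDITIONAL on three PRINT statements that are ALREADY tree-named facts / crux stubs: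
`exists_isNewformOf` (modularity = `stub_modularity`), `realPeriodRat_eq_unit_mul_plusPeriod_two` (the plus period unit at `2` = `stub_periodUnitsAtTwo.1`)
and `integral_neronScaling_of_isGloballyMinimal` (the Néron mapping property, Silverman ATAEC IV.5–6, `Literature/…/NeronIsogenyScaling.lean`).
BSD is not proved by this; C1 is not closed by this.

Context (`Cruxes/MainConjectureTransportAlignedAtTwo/Lines/birth-deltapos-galois-plan.md` input T4; memo `DELTA-POS-ENGINE-att-p4-g13.md` §3(c)). The Galois
route to the `Δ > 0` residual needs, for EACH curve `W` of the cell (globally minimal, good ordinary at `2`, no rational `2`-torsion abscissa), a datum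
`D : ModularParametrizationData W N(W)` with ODD Manin constant `D.c` ((K2) `…DeltaPosFunctional`; capstones `…DeltaPosCongruence` (equal conductors, p669442)
and att-p3 g14's (G4)). For OPTIMAL curves this is Abbes–Ullmo; this file gets it for ALL cell curves:

* `exists_isNewformOf` ⟹ `exists_optimal_modularParametrizationData` (tree `…_of_modularity`): `W ~ W₀` with `W₀` globally minimal carrying the minimal-degree
  datum `D₀` of the newform of `W`, which is lattice-optimal (`Λ_{W₀} = c₀Λ_f`, tree `latticeEq_of_forall_modularDegree_le`);
* the period unit ⟹ `c₀` odd (tree `realPeriodRat_eq_unit_mul_plusPeriod_two_iff_maninConstant_odd`; `W₀` is good at `2` since `2 ∤ N(W)`, and `W₀[2]` is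
  irreducible because `W[2]` is and the two are linked by an odd isogeny);
* no rational `2`-torsion ⟹ an ODD-degree `ℚ`-isogeny between the short models (att-p4 g8 `exists_isogeny_odd_degree_of_ratTwoTorsionCard_eq_one`), whose
  rational multiplier `q` has `qΛ_W ⊆ Λ_{W₀}` and `#ker = deg` (tree `degree_eq_natCard_ker_mulQuotientMap_of_baseChange_eq_curve`); the Néron mapping
  property makes `q = k` and `deg/q = k'` integers, `kk' = deg` ODD, and `k'Λ_{W₀} ⊆ Λ_W` (Lagrange, tree `mul_inv_mul_mem_of_natCard_ker_mulQuotientMap`);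
* so `c := k'c₀` is ODD with `cΛ_f ⊆ Λ_W`, and `(D₀.f, Λ_W, c)` is a datum of `W` (tree `ModularParametrizationData.exists_of_isNewformOf`).

Main: **`exists_datum_odd_maninConstant`**. Auxiliary: `ratTwoTorsionCard_eq_of_equivariant`, `hasIrreducibleModPGaloisRep_two_of_equivariant` (transfer
along a `Γ_ℚ`-equivariant `W[2] ≃ W'[2]`, supplied for odd isogenies by `…FineRoad.OddIsogeny.exists_torsionIso_two_of_isogeny_of_odd_degree`).

References: Abbes–Ullmo 1996 Thm A [AbbesUllmo1996]; Edixhoven 1991 Prop. 2 [EdixhovenManin1991]; Silverman AEC VI.4.1, ATAEC IV.5–6 [SilvermanAEC2009]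
[Silverman1994]; Pasten 2024 §3 [PastenShimura2024]; Cremona 1997 §2.10 [CremonaAlgorithms1997].
-/

noncomputable section

-- justification: the `Summit.BirchSwinnertonDyer.BirchSwinnertonDyer.…` path repeats a component (route-file convention)
set_option linter.dupNamespace false
set_option autoImplicit false

open scoped Classical ModularForm
open Complex CongruenceSubgroup WeierstrassCurve
open Literature.NumberTheory.EllipticCurves Literature.NumberTheory.EllipticCurves.ModularForms Literature.NumberTheory.Automorphic
open Literature.NumberTheory.EllipticCurves.Greenberg1999
open Summit.BirchSwinnertonDyer.Rank1Residual.F1Sign2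
open Summit.BirchSwinnertonDyer.BirchSwinnertonDyer.Theorems.AlignedTransportAtTwoRhombicOfNegDisc
open Summit.BirchSwinnertonDyer.BirchSwinnertonDyer.Theorems.AlignedTransportAtTwoFineRoad.OddIsogeny

namespace Summit.BirchSwinnertonDyer.BirchSwinnertonDyer.Theorems.AlignedTransportAtTwoDeltaPosOddManin

/-! ## §1 Transfer of the `2`-torsion Galois structure along an equivariant isomorphism -/

section Transfer

variable {W W' : WeierstrassCurve ℚ}

/-- `#E(ℚ)[2]` is invariant under a `Γ_ℚ`-equivariant isomorphism `W[2] ≃ W'[2]`. [folklore] -/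
theorem ratTwoTorsionCard_eq_of_equivariant (e : geomTorsion W (2 : ℤ) ≃+ geomTorsion W' (2 : ℤ))
    (he : ∀ (σ : Field.absoluteGaloisGroup ℚ) (P : geomTorsion W (2 : ℤ)), e (σ • P) = σ • e P) :
    ratTwoTorsionCard W = ratTwoTorsionCard W' := by
  unfold ratTwoTorsionCard
  have he' : ∀ (σ : Field.absoluteGaloisGroup ℚ) (Q : geomTorsion W' (2 : ℤ)), e.symm (σ • Q) = σ • e.symm Q := fun σ Q ↦ by
    apply e.injective
    rw [he, e.apply_symm_apply, e.apply_symm_apply]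
  refine Nat.card_congr
    { toFun := fun P ↦ ⟨e P.1, fun σ ↦ by rw [← he, show σ • (P.1 : geomTorsion W (2 : ℤ)) = P.1 from P.2 σ]⟩
      invFun := fun Q ↦ ⟨e.symm Q.1, fun σ ↦ by rw [← he', show σ • (Q.1 : geomTorsion W' (2 : ℤ)) = Q.1 from Q.2 σ]⟩
      left_inv := fun P ↦ by simp
      right_inv := fun Q ↦ by simp }

/-- Irreducibility of `E[2]` is invariant under a `Γ_ℚ`-equivariant isomorphism `W[2] ≃ W'[2]`. [folklore] -/
theorem hasIrreducibleModPGaloisRep_two_of_equivariant (e : geomTorsion W (2 : ℤ) ≃+ geomTorsion W' (2 : ℤ))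
    (he : ∀ (σ : Field.absoluteGaloisGroup ℚ) (P : geomTorsion W (2 : ℤ)), e (σ • P) = σ • e P)
    (h : W.HasIrreducibleModPGaloisRep 2) : W'.HasIrreducibleModPGaloisRep 2 := by
  intro H' hH'
  have he' : ∀ (σ : Field.absoluteGaloisGroup ℚ) (Q : geomTorsion W' (2 : ℤ)), e.symm (σ • Q) = σ • e.symm Q := fun σ Q ↦ by
    apply e.injective
    rw [he, e.apply_symm_apply, e.apply_symm_apply]
  rcases h (H'.comap e.toAddMonoidHom) (fun σ P hP ↦ by
      rw [AddSubgroup.mem_comap] at hP ⊢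
      change e (σ • P) ∈ H'
      rw [he]; exact hH' σ _ hP) with hbot | htop
  · left
    rw [eq_bot_iff]
    intro Q hQ
    have : e.symm Q ∈ H'.comap e.toAddMonoidHom := by
      rw [AddSubgroup.mem_comap]; change e (e.symm Q) ∈ H'; rwa [e.apply_symm_apply]
    rw [hbot, AddSubgroup.mem_bot] at this
    rw [AddSubgroup.mem_bot, ← e.apply_symm_apply Q, this, map_zero]
  · right
    rw [eq_top_iff]
    intro Q _
    have : e.symm Q ∈ H'.comap e.toAddMonoidHom := by rw [htop]; exact AddSubgroup.mem_top _
    rw [AddSubgroup.mem_comap] at this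
    change e (e.symm Q) ∈ H' at this
    rwa [e.apply_symm_apply] at this

/-- Along an ODD-degree `ℚ`-isogeny `#E(ℚ)[2]` and the irreducibility of `E[2]` are preserved. [cite: SilvermanAEC2009, III.4 and III.6] -/
theorem ratTwoTorsionCard_eq_and_irr_of_isogeny_of_odd_degree [W.IsElliptic] [W'.IsElliptic] (φ : Isogeny W W') (hodd : Odd φ.degree) :
    ratTwoTorsionCard W = ratTwoTorsionCard W' ∧ (W.HasIrreducibleModPGaloisRep 2 → W'.HasIrreducibleModPGaloisRep 2) := by
  obtain ⟨e, -, he⟩ := exists_torsionIso_two_of_isogeny_of_odd_degree (K := ℚ) two_ne_zero φ hodd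
  exact ⟨ratTwoTorsionCard_eq_of_equivariant e he, hasIrreducibleModPGaloisRep_two_of_equivariant e he⟩

end Transfer

/-! ## §2 The datum with odd Manin constant -/

/-- **T4: every curve of the cell has a parametrisation datum at the level of its conductor with ODD Manin constant**, from modularity, the plus period unit
at `2` and the Néron mapping property (all PRINT, all already in the tree). See the module docstring for the proof.
[cite: AbbesUllmo1996, Thm. A] [cite: EdixhovenManin1991, Prop. 2] [cite: SilvermanAEC2009, Thm. VI.4.1] [cite: Silverman1994, IV.5–6] [cite: PastenShimura2024, §3 p. 13] -/
theorem exists_datum_odd_maninConstant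
    (hmod : exists_isNewformOf) (hNS : integral_neronScaling_of_isGloballyMinimal) (hΩu : realPeriodRat_eq_unit_mul_plusPeriod_two)
    (W : WeierstrassCurve ℚ) [W.IsElliptic] [W.IsGloballyMinimal] (hord : IsOrdinaryAt W 2) (ht : ∀ x : ℚ, ¬ HasRationalTwoTorsionX W x)
    [NeZero (W.conductorNorm ℤ)] :
    ∃ D : ModularParametrizationData W (W.conductorNorm ℤ), Odd D.c := by
  haveI : (W.baseChange ℂ).IsElliptic := by rw [WeierstrassCurve.baseChange]; infer_instance
  -- §0 the optimal curve `W₀ ~ W` and its lattice-optimal datum `D₀`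
  obtain ⟨W₀, hW₀, hW₀min, D₀, hfW, hisoW, hmin⟩ := exists_optimal_modularParametrizationData_of_modularity hmod (W.conductorNorm ℤ) W rfl
  haveI := hW₀
  haveI := hW₀min
  haveI : (W₀.baseChange ℂ).IsElliptic := by rw [WeierstrassCurve.baseChange]; infer_instance
  have hlatt₀ : ∀ z ∈ D₀.L.lattice, ∃ w ∈ periodLattice D₀.f, z = D₀.c * w := D₀.latticeEq_of_forall_modularDegree_le hmin
  have h2N : ¬ 2 ∣ W.conductorNorm ℤ := not_dvd_level_of_isNewformOf hfW hord.1
  -- §1 the Néron lattice of `W`, the two short models and an ODD-degree isogeny between them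
  obtain ⟨LW, hLW⟩ := exists_isNeronLatticeOf_holds (W.baseChange ℂ)
  set C : VariableChange ℚ := ⟨1, -W.b₂ / 12, -W.a₁ / 2, W.a₁ * W.b₂ / 24 - W.a₃ / 2⟩ with hC
  set C₀ : VariableChange ℚ := ⟨1, -W₀.b₂ / 12, -W₀.a₁ / 2, W₀.a₁ * W₀.b₂ / 24 - W₀.a₃ / 2⟩ with hC₀
  have hE : (C • W).baseChange ℂ = LW.curve := shortModel_baseChange_eq_curve W hLW
  have hE₀ : (C₀ • W₀).baseChange ℂ = D₀.L.curve := shortModel_baseChange_eq_curve W₀ D₀.isNeronLattice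
  have hiso : IsIsogenous (C • W) (C₀ • W₀) := (isIsogenous_of_smul W C).trans' (hisoW.trans' (isIsogenous_smul W₀ C₀))
  obtain ⟨ψ⟩ := hiso
  -- no rational `2`-torsion on the short model (degree-one isogeny `W → C • W`)
  have h1 : ratTwoTorsionCard (C • W) = 1 := by
    rw [← (ratTwoTorsionCard_eq_and_irr_of_isogeny_of_odd_degree (VariableChange.toIsogeny W C)
      (by rw [VariableChange.degree_toIsogeny]; exact odd_one)).1]
    exact ratTwoTorsionCard_eq_one_of_forall_not_hasRationalTwoTorsionX W ht
  obtain ⟨φ, hφodd⟩ := exists_isogeny_odd_degree_of_ratTwoTorsionCard_eq_one h1 ψ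
  -- §2 its rational multiplier `q`: `qΛ_W ⊆ Λ_{W₀}`, `#ker = deg φ`; Néron scaling: `q = k`, `deg/q = k'` integers, `kk'` odd
  obtain ⟨q, hq0, hq, hdeg⟩ := degree_eq_natCard_ker_mulQuotientMap_of_baseChange_eq_curve φ hE hE₀
  have hqC : (q : ℂ) ≠ 0 := by exact_mod_cast hq0
  obtain ⟨k, hk⟩ := hNS W W₀ LW D₀.L hLW D₀.isNeronLattice q hq
  have hq' : ∀ z ∈ D₀.L.lattice, (((φ.degree : ℚ) / q : ℚ) : ℂ) * z ∈ LW.lattice := fun z hz ↦ by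
    have hmem := mul_inv_mul_mem_of_natCard_ker_mulQuotientMap (Λ₀ := LW.lattice.toAddSubgroup)
      (Λ := D₀.L.lattice.toAddSubgroup) hqC (hq := hq) (show z ∈ D₀.L.lattice.toAddSubgroup from hz)
    rw [← hdeg] at hmem
    have hcast : (((φ.degree : ℚ) / q : ℚ) : ℂ) * z = (φ.degree : ℂ) * ((q : ℂ)⁻¹ * z) := by
      push_cast
      field_simp
    rw [hcast]
    exact hmem
  obtain ⟨k', hk'⟩ := hNS W₀ W D₀.L LW D₀.isNeronLattice hLW _ hq'
  have hkk' : k * k' = φ.degree := by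
    have h1 : (k : ℚ) * k' = φ.degree := by rw [hk, hk', mul_div_cancel₀ _ hq0]
    exact_mod_cast h1
  have hk'odd : Odd k' := by
    have hodd : Odd (k * k') := by rw [hkk']; exact_mod_cast hφodd
    exact (Int.odd_mul.mp hodd).2
  -- §3 `c₀` is odd: `W₀` is good at `2`, `W₀[2]` is irreducible (odd isogenies), `D₀` is lattice-optimal, and the period unit
  have hgood₀ : W₀.HasGoodReductionAtPrime 2 := hasGoodReductionAtPrime_of_isNewformOf_of_not_dvd_level D₀.isNewformOf h2N
  have hirr : W.HasIrreducibleModPGaloisRep 2 := by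
    by_contra hred
    obtain ⟨x₀, hx₀⟩ := W.exists_isRoot_twoTorsionPolynomial_of_not_hasIrreducibleModPGaloisRep_two hred
    refine ht x₀ ?_
    rw [isRoot_twoTorsionPolynomial_iff] at hx₀
    refine ⟨-(W.a₁ * x₀ + W.a₃) / 2, ?_, by ring⟩
    rw [WeierstrassCurve.Affine.equation_iff]
    simp only [WeierstrassCurve.b₂, WeierstrassCurve.b₄, WeierstrassCurve.b₆] at hx₀
    linear_combination (-1 / 4 : ℚ) * hx₀
  have hirr₀ : W₀.HasIrreducibleModPGaloisRep 2 := by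
    have h₁ := (ratTwoTorsionCard_eq_and_irr_of_isogeny_of_odd_degree (VariableChange.toIsogeny W C)
      (by rw [VariableChange.degree_toIsogeny]; exact odd_one)).2 hirr
    have h₂ := (ratTwoTorsionCard_eq_and_irr_of_isogeny_of_odd_degree φ hφodd).2 h₁
    have h₃ := (ratTwoTorsionCard_eq_and_irr_of_isogeny_of_odd_degree (VariableChange.toIsogeny (C₀ • W₀) C₀⁻¹)
      (by rw [VariableChange.degree_toIsogeny]; exact odd_one)).2 h₂
    rwa [inv_smul_smul] at h₃
  have hc₀ : Odd D₀.c := by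
    have h := (realPeriodRat_eq_unit_mul_plusPeriod_two_iff_maninConstant_odd.mp hΩu) W₀ hgood₀ hirr₀ D₀ hlatt₀
    rcases Int.even_or_odd D₀.c with heven | hodd
    · exact absurd (even_iff_two_dvd.mp heven) h
    · exact hodd
  -- §4 the datum `(D₀.f, Λ_W, k'c₀)` of `W`
  have hc : k' * D₀.c ≠ 0 := by
    intro h0
    rcases mul_eq_zero.mp h0 with h | h
    · rw [h] at hk'odd; exact (by decide : ¬ Odd (0 : ℤ)) hk'odd
    · rw [h] at hc₀; exact (by decide : ¬ Odd (0 : ℤ)) hc₀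
  have hle : ∀ z ∈ periodLattice D₀.f, ((k' * D₀.c : ℤ) : ℂ) * z ∈ LW.lattice := fun z hz ↦ by
    have h2 := hq' _ (D₀.smul_periodLattice_le z hz)
    rw [← hk', Rat.cast_intCast, ← mul_assoc] at h2
    push_cast
    exact h2
  obtain ⟨D, -, -, hDc⟩ := ModularParametrizationData.exists_of_isNewformOf hfW hLW hc hle
  exact ⟨D, by rw [hDc]; exact hk'odd.mul hc₀⟩

end Summit.BirchSwinnertonDyer.BirchSwinnertonDyer.Theorems.AlignedTransportAtTwoDeltaPosOddManin

end
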